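import Mathlib.MeasureTheory.Covering.Besicovitch
import Mathlib.MeasureTheory.Covering.BesicovitchVectorSpace
import Mathlib.MeasureTheory.Measure.Lebesgue.EqHaar
import Mathlib.MeasureTheory.Integral.Bochner.Set
import Literature.Analysis.FluidPDE.ConvexIntegration2D
import HarnessLib

/-!
# Convex integration in 2-D: reduction of Lemma 3.7 of Chiodaroli–De Lellis–Kreml to balls

Topic `Analysis/FluidPDE`. This file is the first (top) layer of the decomposition of the named
fact `Literature.Analysis.FluidPDE.ConvexIntegration.ConvexIntegrationLemma2D`
(`Literature/Analysis/FluidPDE/ConvexIntegration2D.lean`; Chiodaroli–De Lellis–Kreml,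
CPAM 68 (2015), Lemma 3.7) into provable pieces.

* `IsCISolution Ω v₀ u₀ C v` — one admissible velocity field on `Ω` (measurable, `|v|² = C`
  a.e. on `Ω`, and the two linear conservation laws of Lemma 3.7 (ii) for the perturbation
  extended by zero outside `Ω`, tested against `C_c^∞(ℝ × ℝ²)`), literally the `∀ n`-body of
  `ConvexIntegrationLemma2D`;
* `HasWildFamily Ω v₀ u₀ C` — a sequence of such fields, pairwise not a.e. equal on `Ω`
  ("infinitely many"), literally the conclusion of `ConvexIntegrationLemma2D`
  (`convexIntegrationLemma2D_iff` is `Iff.rfl`);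
* `ConvexIntegrationLemma2DBall` — the named fact: Lemma 3.7 for `Ω` a ball of `ℝ × ℝ²`. With
  the product (sup) metric of `ℝ × EuclideanSpace ℝ (Fin 2)` the ball `B((t₀, x₀), r)` is the
  cylinder `]t₀ - r, t₀ + r[ × B_r(x₀)`, i.e. exactly the cells `B_r(x₀) × ]t₀ - r, t₀ + r[` on
  which the source runs its construction (CDK 2015, §4.1, proof of claim (Cl));
* `hasWildFamily_of_cover` — gluing: if `Ω` is covered up to a null set by countably many
  pairwise disjoint open sets `Bᵢ ⊆ Ω` each carrying a wild family, then `Ω` carries one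
  (the perturbations have disjoint supports, so the linear equations and the pointwise constraint
  add up; distinct members on one fixed `Bᵢ₀` give distinct members on `Ω`). This is the
  argument of CDK 2015, proof of Prop. 3.6 from Lemma 3.7 (p. 1166: "we apply Lemma 3.7 in each
  region … since `v̲ᵢ` is supported in `Pᵢ` …"), here with countably many regions;
* `convexIntegrationLemma2D_of_ball : ConvexIntegrationLemma2DBall → ConvexIntegrationLemma2D` —
  by the measurable Besicovitch covering theorem (Mathlib
  `Besicovitch.exists_disjoint_closedBall_covering_ae`) every open `Ω ⊆ ℝ × ℝ²` is covered, up
  to a Lebesgue-null set, by countably many pairwise disjoint closed balls contained in `Ω`;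
  spheres are null, so the open balls qualify for `hasWildFamily_of_cover`.

The remaining (lower) layers — the geometric lemma (CDK Lemma 4.3), localized plane waves
(CDK Prop. 4.1) and the iteration on one ball — live in sibling files
`ConvexIntegration2D*.lean`; the plan is recorded in the literature-prover's notes.

## References

* E. Chiodaroli, C. De Lellis, O. Kreml, *Global ill-posedness of the isentropic system of gas
  dynamics*, Comm. Pure Appl. Math. 68 (2015) 1157–1190, Lemma 3.7, proof of Prop. 3.6, §4.1.
-/

noncomputable section

open MeasureTheory Set Metric Filter Function

namespace Literature.Analysis.FluidPDE.ConvexIntegration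

/-! ### One admissible field, a wild family -/

/-- `IsCISolution Ω v₀ u₀ C v`: the velocity field `v : ℝ × ℝ² → ℝ²` is *admissible on `Ω` for
the data `(v₀, u₀, C)`* in the sense of Lemma 3.7 of Chiodaroli–De Lellis–Kreml: it is
measurable, `|v|² = C` a.e. on `Ω`, and with `v̲ := 1_Ω (v - v₀)`,
`u̲ := 1_Ω (v ⊗ v - (C/2) Id - u₀)` the linear system `div_x v̲ = 0`, `∂ₜ v̲ + div_x u̲ = 0`
holds in `𝒟'(ℝ × ℝ²)`, i.e. `∫_Ω (v - v₀) · ∇ₓφ = 0` and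
`∫_Ω [(v - v₀) · ∂ₜw + (v ⊗ v - (C/2) Id - u₀) : ∇ₓw] = 0` for all test functions `φ`, `w`
on `ℝ × ℝ²`. This is literally the body of `ConvexIntegrationLemma2D` for one member of the
family. [cite: ChiodaroliDeLellisKreml2015, Lemma 3.7 (i)–(iii)] -/
def IsCISolution (Ω : Set (ℝ × EuclideanSpace ℝ (Fin 2))) (v₀ : EuclideanSpace ℝ (Fin 2))
    (u₀ : Matrix (Fin 2) (Fin 2) ℝ) (C : ℝ)
    (v : ℝ × EuclideanSpace ℝ (Fin 2) → EuclideanSpace ℝ (Fin 2)) : Prop :=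
  Measurable v ∧
    (∀ᵐ z ∂(volume.restrict Ω), ‖v z‖ ^ 2 = C) ∧
    (∀ φ : ℝ × EuclideanSpace ℝ (Fin 2) → ℝ,
      Literature.Analysis.FunctionSpaces.IsTestFunctionOn ⊤ φ →
      ∫ z in Ω, ∑ j, (v z j - v₀ j) * fderiv ℝ φ z (0, EuclideanSpace.single j 1) = 0) ∧
    (∀ w : ℝ × EuclideanSpace ℝ (Fin 2) → EuclideanSpace ℝ (Fin 2),
      Literature.Analysis.FunctionSpaces.IsTestFunctionOn ⊤ w →
      ∫ z in Ω, (∑ i, (v z i - v₀ i) * fderiv ℝ w z (1, 0) i +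
        ∑ i, ∑ j, (v z i * v z j - (if i = j then C / 2 else 0) - u₀ i j) *
          fderiv ℝ w z (0, EuclideanSpace.single j 1) i) = 0)

/-- `HasWildFamily Ω v₀ u₀ C`: there is a sequence of admissible fields on `Ω` for the data
`(v₀, u₀, C)` which are pairwise not a.e. equal on `Ω` — the conclusion ("infinitely many maps")
of Lemma 3.7 of Chiodaroli–De Lellis–Kreml for the set `Ω`.
[cite: ChiodaroliDeLellisKreml2015, Lemma 3.7] -/
def HasWildFamily (Ω : Set (ℝ × EuclideanSpace ℝ (Fin 2))) (v₀ : EuclideanSpace ℝ (Fin 2))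
    (u₀ : Matrix (Fin 2) (Fin 2) ℝ) (C : ℝ) : Prop :=
  ∃ v : ℕ → ℝ × EuclideanSpace ℝ (Fin 2) → EuclideanSpace ℝ (Fin 2),
    (∀ n n', n ≠ n' → ¬ (v n =ᵐ[volume.restrict Ω] v n')) ∧ ∀ n, IsCISolution Ω v₀ u₀ C (v n)

/-- `ConvexIntegrationLemma2D` unfolds to: every non-empty open `Ω` carries a wild family for
every strict constant subsolution `(v₀, u₀, C)` (definitional, `Iff.rfl`).
[cite: ChiodaroliDeLellisKreml2015, Lemma 3.7] -/
theorem convexIntegrationLemma2D_iff :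
    ConvexIntegrationLemma2D ↔
      ∀ (Ω : Set (ℝ × EuclideanSpace ℝ (Fin 2))), IsOpen Ω → Ω.Nonempty →
      ∀ (v₀ : EuclideanSpace ℝ (Fin 2)) (u₀ : Matrix (Fin 2) (Fin 2) ℝ) (C : ℝ),
        u₀.IsSymm → u₀.trace = 0 → 0 < C →
        ((C / 2) • (1 : Matrix (Fin 2) (Fin 2) ℝ) - (Matrix.vecMulVec v₀ v₀ - u₀)).PosDef →
        HasWildFamily Ω v₀ u₀ C :=
  Iff.rfl

/-- **Lemma 3.7 of Chiodaroli–De Lellis–Kreml on a ball (cylinder).** For every ball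
`B((t₀, x₀), r) = ]t₀ - r, t₀ + r[ × B_r(x₀)` of `ℝ × ℝ²` (`r > 0`; product metric), every
`v₀ ∈ ℝ²`, symmetric trace-free `u₀` and `C > 0` with `(C/2) Id - (v₀ ⊗ v₀ - u₀)` positive
definite, the ball carries a wild family: infinitely many (pairwise not a.e. equal) bounded
measurable `v` with `|v|² = C` a.e. on the ball and `div_x v̲ = 0`, `∂ₜv̲ + div_x u̲ = 0` in
`𝒟'(ℝ × ℝ²)` for `v̲ = 1_B (v - v₀)`, `u̲ = 1_B (v ⊗ v - (C/2) Id - u₀)`. This is the special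
case `Ω = B_r(x₀) × ]t₀ - r, t₀ + r[` of the printed lemma, and the case its proof actually
treats (CDK 2015, §4.1: the construction is run on the cells `B_r(x_j) × ]t_j - r, t_j + r[`).
Named fact (not yet proved here; its proof is the convex-integration iteration from the
geometric lemma, CDK Lemma 4.3, and localized plane waves, CDK Prop. 4.1).
[cite: ChiodaroliDeLellisKreml2015, Lemma 3.7 (case Ω = B_r(x₀) × ]t₀ - r, t₀ + r[), §4.1] -/
def ConvexIntegrationLemma2DBall : Prop :=
  ∀ (z₀ : ℝ × EuclideanSpace ℝ (Fin 2)) (r : ℝ), 0 < r →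
  ∀ (v₀ : EuclideanSpace ℝ (Fin 2)) (u₀ : Matrix (Fin 2) (Fin 2) ℝ) (C : ℝ),
    u₀.IsSymm → u₀.trace = 0 → 0 < C →
    ((C / 2) • (1 : Matrix (Fin 2) (Fin 2) ℝ) - (Matrix.vecMulVec v₀ v₀ - u₀)).PosDef →
    HasWildFamily (ball z₀ r) v₀ u₀ C

/-! ### Integrability of the two integrands -/

section Integrands

variable {v₀ : EuclideanSpace ℝ (Fin 2)} {u₀ : Matrix (Fin 2) (Fin 2) ℝ} {C : ℝ}
variable {S : Set (ℝ × EuclideanSpace ℝ (Fin 2))}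
variable {v : ℝ × EuclideanSpace ℝ (Fin 2) → EuclideanSpace ℝ (Fin 2)}

/-- A field with `|v|² = C` a.e. on `S` has a.e. bounded components on `S`. [folklore] -/
theorem ae_norm_apply_sub_le (hS : ∀ᵐ z ∂(volume.restrict S), ‖v z‖ ^ 2 = C) (j : Fin 2) :
    ∀ᵐ z ∂(volume.restrict S), ‖v z j - v₀ j‖ ≤ Real.sqrt C + ‖v₀‖ := by
  filter_upwards [hS] with z hz
  calc ‖v z j - v₀ j‖ ≤ ‖v z j‖ + ‖v₀ j‖ := norm_sub_le _ _
    _ ≤ ‖v z‖ + ‖v₀‖ := add_le_add (PiLp.norm_apply_le (v z) j) (PiLp.norm_apply_le v₀ j)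
    _ = Real.sqrt C + ‖v₀‖ := by rw [← hz, Real.sqrt_sq (norm_nonneg _)]

/-- A field with `|v|² = C` a.e. on `S` has a.e. bounded quadratic stress entries on `S`.
[folklore] -/
theorem ae_norm_stress_le (hS : ∀ᵐ z ∂(volume.restrict S), ‖v z‖ ^ 2 = C) (i j : Fin 2) :
    ∀ᵐ z ∂(volume.restrict S),
      ‖v z i * v z j - (if i = j then C / 2 else 0) - u₀ i j‖ ≤ C + |C| / 2 + |u₀ i j| := by
  filter_upwards [hS] with z hz
  have hi : ‖v z i‖ ≤ ‖v z‖ := PiLp.norm_apply_le (v z) i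
  have hj : ‖v z j‖ ≤ ‖v z‖ := PiLp.norm_apply_le (v z) j
  have hij : ‖v z i * v z j‖ ≤ C := by
    rw [norm_mul, ← hz, sq]
    exact mul_le_mul hi hj (norm_nonneg _) (norm_nonneg _)
  have hδ : ‖(if i = j then C / 2 else 0 : ℝ)‖ ≤ |C| / 2 := by
    split_ifs
    · rw [Real.norm_eq_abs, abs_div, abs_two]
    · simp only [norm_zero]; positivity
  calc ‖v z i * v z j - (if i = j then C / 2 else 0) - u₀ i j‖
      ≤ ‖v z i * v z j‖ + ‖(if i = j then C / 2 else 0 : ℝ)‖ + ‖u₀ i j‖ :=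
        (norm_sub_le _ _).trans (add_le_add_left (norm_sub_le _ _) _)
    _ ≤ C + |C| / 2 + |u₀ i j| := by
        rw [Real.norm_eq_abs (u₀ i j)]
        exact add_le_add (add_le_add hij hδ) le_rfl

/-- Components of a measurable `ℝ²`-valued field are measurable. [folklore] -/
theorem measurable_apply_comp (hv : Measurable v) (j : Fin 2) : Measurable fun z => v z j :=
  (PiLp.continuous_apply 2 _ j).measurable.comp hv

/-- The divergence-free integrand of Lemma 3.7 (ii) is integrable on `S` for an admissible
field. [folklore] -/
theorem integrableOn_divIntegrand (hv : Measurable v)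
    (hS : ∀ᵐ z ∂(volume.restrict S), ‖v z‖ ^ 2 = C)
    {φ : ℝ × EuclideanSpace ℝ (Fin 2) → ℝ}
    (hφ : Literature.Analysis.FunctionSpaces.IsTestFunctionOn ⊤ φ) :
    IntegrableOn
      (fun z => ∑ j, (v z j - v₀ j) * fderiv ℝ φ z (0, EuclideanSpace.single j 1)) S := by
  refine integrable_finsetSum _ fun j _ => ?_
  have hg : Integrable (fun z : ℝ × EuclideanSpace ℝ (Fin 2) =>
      fderiv ℝ φ z (0, EuclideanSpace.single j 1)) (volume.restrict S) :=
    (((hφ.contDiff.continuous_fderiv (by simp)).clm_apply continuous_const)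
      |>.integrable_of_hasCompactSupport (hφ.hasCompactSupport.fderiv_apply ℝ _)).integrableOn
  exact hg.bdd_mul ((measurable_apply_comp hv j).sub measurable_const).aestronglyMeasurable
    (ae_norm_apply_sub_le hS j)

/-- The momentum integrand of Lemma 3.7 (ii) is integrable on `S` for an admissible field.
[folklore] -/
theorem integrableOn_momIntegrand (hv : Measurable v)
    (hS : ∀ᵐ z ∂(volume.restrict S), ‖v z‖ ^ 2 = C)
    {w : ℝ × EuclideanSpace ℝ (Fin 2) → EuclideanSpace ℝ (Fin 2)}
    (hw : Literature.Analysis.FunctionSpaces.IsTestFunctionOn ⊤ w) :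
    IntegrableOn
      (fun z => ∑ i, (v z i - v₀ i) * fderiv ℝ w z (1, 0) i +
        ∑ i, ∑ j, (v z i * v z j - (if i = j then C / 2 else 0) - u₀ i j) *
          fderiv ℝ w z (0, EuclideanSpace.single j 1) i) S := by
  have hcomp : ∀ (e : ℝ × EuclideanSpace ℝ (Fin 2)) (i : Fin 2),
      Integrable (fun z : ℝ × EuclideanSpace ℝ (Fin 2) => fderiv ℝ w z e i)
        (volume.restrict S) := by
    intro e i
    refine (Continuous.integrable_of_hasCompactSupport ?_ ?_).integrableOn
    · exact (PiLp.continuous_apply 2 _ i).comp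
        ((hw.contDiff.continuous_fderiv (by simp)).clm_apply continuous_const)
    · exact (hw.hasCompactSupport.fderiv_apply ℝ e).comp_left (g := fun a => a i) rfl
  refine Integrable.add (integrable_finsetSum _ fun i _ => ?_)
    (integrable_finsetSum _ fun i _ => integrable_finsetSum _ fun j _ => ?_)
  · exact (hcomp (1, 0) i).bdd_mul
      ((measurable_apply_comp hv i).sub measurable_const).aestronglyMeasurable
      (ae_norm_apply_sub_le hS i)
  · exact (hcomp (0, EuclideanSpace.single j 1) i).bdd_mul
      ((((measurable_apply_comp hv i).mul (measurable_apply_comp hv j)).sub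
        measurable_const).sub measurable_const).aestronglyMeasurable
      (ae_norm_stress_le hS i j)

end Integrands

/-! ### Gluing wild families along a countable disjoint a.e.-cover -/

section Glue

variable {v₀ : EuclideanSpace ℝ (Fin 2)} {u₀ : Matrix (Fin 2) (Fin 2) ℝ} {C : ℝ}

/-- **Gluing.** If the set `Ω` is covered, up to a Lebesgue-null set, by countably
many pairwise disjoint open sets `Bᵢ ⊆ Ω`, each of which carries a wild family for the data
`(v₀, u₀, C)`, then `Ω` carries a wild family for the same data: paste one member on each `Bᵢ`,
varying the member only on a fixed `Bᵢ₀` (CDK 2015, proof of Prop. 3.6 from Lemma 3.7: the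
perturbations are supported in the disjoint regions, so the equations and the constraint add up).
[cite: ChiodaroliDeLellisKreml2015, proof of Prop. 3.6 (p. 1166)] -/
theorem hasWildFamily_of_cover {Ω : Set (ℝ × EuclideanSpace ℝ (Fin 2))} {ι : Type*} [Countable ι] [Nonempty ι] (B : ι → Set (ℝ × EuclideanSpace ℝ (Fin 2)))
    (hBo : ∀ i, IsOpen (B i)) (hdisj : Pairwise (Disjoint on B)) (hsub : ∀ i, B i ⊆ Ω)
    (hnull : volume (Ω \ ⋃ i, B i) = 0) (hB : ∀ i, HasWildFamily (B i) v₀ u₀ C) :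
    HasWildFamily Ω v₀ u₀ C := by
  classical
  choose w hw using hB
  obtain ⟨e, he⟩ := exists_surjective_nat ι
  set U : Set (ℝ × EuclideanSpace ℝ (Fin 2)) := ⋃ i, B i with hU
  have hUo : IsOpen U := isOpen_iUnion hBo
  have hUΩ : U ⊆ Ω := iUnion_subset hsub
  -- the `m`-th member on the piece `i`: vary only on the piece `e 0`
  set sol : ℕ → ι → (ℝ × EuclideanSpace ℝ (Fin 2)) → EuclideanSpace ℝ (Fin 2) :=
    fun m i => if i = e 0 then w i m else w i 0 with hsol_def
  have hsol : ∀ m i, IsCISolution (B i) v₀ u₀ C (sol m i) := by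
    intro m i
    by_cases h : i = e 0
    · simp only [hsol_def, h, if_true]; exact (hw (e 0)).2 m
    · simp only [hsol_def, h, if_false]; exact (hw i).2 0
  -- countably many pieces indexed by `ℕ`, with a catch-all outside `U`
  set p : ℕ → (ℝ × EuclideanSpace ℝ (Fin 2)) → Prop := fun n z => z ∈ B (e n) ∨ z ∉ U with hp_def
  have hp : ∀ z, ∃ n, p n z := by
    intro z
    by_cases hz : z ∈ U
    · obtain ⟨i, hi⟩ := mem_iUnion.mp hz
      obtain ⟨n, rfl⟩ := he i
      exact ⟨n, Or.inl hi⟩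
    · exact ⟨0, Or.inr hz⟩
  set V : ℕ → (ℝ × EuclideanSpace ℝ (Fin 2)) → EuclideanSpace ℝ (Fin 2) :=
    fun m z => sol m (e (Nat.find (hp z))) z with hV_def
  have hV_eq : ∀ m i, EqOn (V m) (sol m i) (B i) := by
    intro m i z hz
    have hzU : z ∈ U := mem_iUnion.mpr ⟨i, hz⟩
    have h1 : z ∈ B (e (Nat.find (hp z))) :=
      (Nat.find_spec (hp z)).resolve_right (not_not.mpr hzU)
    have h2 : e (Nat.find (hp z)) = i := by
      by_contra hne
      exact Set.disjoint_left.mp (hdisj hne) h1 hz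
    simp only [hV_def]
    rw [h2]
  have hV_meas : ∀ m, Measurable (V m) := by
    intro m
    refine Measurable.find (f := fun n => sol m (e n)) (p := p) (fun n => (hsol m (e n)).1)
      (fun n => ?_) hp
    exact (hBo (e n)).measurableSet.union hUo.measurableSet.compl
  -- a.e. properties transfer from the pieces to `Ω`
  have hae : ∀ m (P : (ℝ × EuclideanSpace ℝ (Fin 2)) → EuclideanSpace ℝ (Fin 2) → Prop),
      (∀ i, ∀ᵐ z ∂(volume.restrict (B i)), P z (sol m i z)) →
      ∀ᵐ z ∂(volume.restrict Ω), P z (V m z) := by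
    intro m P h
    have h1 : ∀ᵐ z ∂(volume.restrict U), P z (V m z) := by
      refine (ae_restrict_iUnion_iff B _).mpr fun i => ?_
      filter_upwards [ae_restrict_mem (hBo i).measurableSet, h i] with z hz hPz
      rw [hV_eq m i hz]
      exact hPz
    have h2 : ∀ᵐ z ∂(volume.restrict (Ω \ U)), P z (V m z) := by
      rw [Measure.restrict_eq_zero.mpr hnull]
      exact ae_zero.symm ▸ eventually_bot
    exact ae_restrict_of_ae_restrict_of_subset (subset_sdiff_union Ω U)
      ((ae_restrict_union_iff (Ω \ U) U _).mpr ⟨h2, h1⟩)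
  -- integrals over `Ω` split along the pieces
  have hint : ∀ m (F : (ℝ × EuclideanSpace ℝ (Fin 2)) → EuclideanSpace ℝ (Fin 2) → ℝ),
      IntegrableOn (fun z => F z (V m z)) Ω →
      (∀ i, ∫ z in B i, F z (sol m i z) = 0) → ∫ z in Ω, F z (V m z) = 0 := by
    intro m F hF h0
    have hΩU : Ω =ᵐ[volume] U := by
      refine ae_eq_set.mpr ⟨hnull, ?_⟩
      rw [sdiff_eq_empty.mpr hUΩ, measure_empty]
    rw [setIntegral_congr_set hΩU, hU,
      integral_iUnion (fun i => (hBo i).measurableSet) hdisj (hF.mono_set hUΩ)]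
    have : ∀ i, ∫ z in B i, F z (V m z) = 0 := fun i => by
      rw [setIntegral_congr_fun (hBo i).measurableSet (g := fun z => F z (sol m i z))
        fun z hz => by simp only [hV_eq m i hz]]
      exact h0 i
    simp [this]
  refine ⟨V, ?_, fun m => ⟨hV_meas m, ?_, ?_, ?_⟩⟩
  · -- pairwise distinct: already on the piece `e 0`
    intro m m' hmm' heq
    refine (hw (e 0)).1 m m' hmm' ?_
    have h1 : V m =ᵐ[volume.restrict (B (e 0))] V m' :=
      ae_restrict_of_ae_restrict_of_subset (hsub (e 0)) heq
    filter_upwards [ae_restrict_mem (hBo (e 0)).measurableSet, h1] with z hz h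
    have hm : V m z = w (e 0) m z := by rw [hV_eq m (e 0) hz]; simp [hsol_def]
    have hm' : V m' z = w (e 0) m' z := by rw [hV_eq m' (e 0) hz]; simp [hsol_def]
    rw [← hm, ← hm', h]
  · exact hae m (fun _ a => ‖a‖ ^ 2 = C) fun i => (hsol m i).2.1
  · intro φ hφ
    have hnorm : ∀ᵐ z ∂(volume.restrict Ω), ‖V m z‖ ^ 2 = C :=
      hae m (fun _ a => ‖a‖ ^ 2 = C) fun i => (hsol m i).2.1
    exact hint m (fun z a => ∑ j, (a j - v₀ j) * fderiv ℝ φ z (0, EuclideanSpace.single j 1))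
      (integrableOn_divIntegrand (hV_meas m) hnorm hφ) fun i => (hsol m i).2.2.1 φ hφ
  · intro w' hw'
    have hnorm : ∀ᵐ z ∂(volume.restrict Ω), ‖V m z‖ ^ 2 = C :=
      hae m (fun _ a => ‖a‖ ^ 2 = C) fun i => (hsol m i).2.1
    exact hint m (fun z a => ∑ i, (a i - v₀ i) * fderiv ℝ w' z (1, 0) i +
        ∑ i, ∑ j, (a i * a j - (if i = j then C / 2 else 0) - u₀ i j) *
          fderiv ℝ w' z (0, EuclideanSpace.single j 1) i)
      (integrableOn_momIntegrand (hV_meas m) hnorm hw') fun i => (hsol m i).2.2.2 w' hw'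

end Glue

/-! ### From balls to arbitrary open sets -/

/-- **Reduction of Lemma 3.7 to balls.** If every ball (cylinder) of `ℝ × ℝ²` carries a wild
family for every strict constant subsolution, then so does every non-empty open set: cover `Ω`
up to a null set by countably many pairwise disjoint closed balls contained in `Ω` (measurable
Besicovitch covering theorem), discard the null spheres, and glue (`hasWildFamily_of_cover`).
[cite: ChiodaroliDeLellisKreml2015, Lemma 3.7 with §4.1 and proof of Prop. 3.6] -/
theorem convexIntegrationLemma2D_of_ball (h : ConvexIntegrationLemma2DBall) :
    ConvexIntegrationLemma2D := by
  intro Ω hΩo hΩne v₀ u₀ C hsymm htr hC hpos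
  haveI : (volume : Measure (ℝ × EuclideanSpace ℝ (Fin 2))).IsAddHaarMeasure :=
    Measure.prod.instIsAddHaarMeasure _ _
  -- Besicovitch: a.e. cover of `Ω` by disjoint closed balls inside `Ω`
  obtain ⟨t, r, tcount, -, hr, hnull, hdisj⟩ :=
    Besicovitch.exists_disjoint_closedBall_covering_ae
      (volume : Measure (ℝ × EuclideanSpace ℝ (Fin 2)))
      (fun x => {ρ | closedBall x ρ ⊆ Ω}) Ω (fun x hx δ hδ => by
        obtain ⟨ε, hε, hball⟩ := Metric.isOpen_iff.mp hΩo x hx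
        refine ⟨min (ε / 2) (δ / 2), ?_, ?_, ?_⟩
        · exact (closedBall_subset_ball
            ((min_le_left _ _).trans_lt (half_lt_self hε))).trans hball
        · exact lt_min (half_pos hε) (half_pos hδ)
        · exact (min_le_right _ _).trans_lt (half_lt_self hδ))
      (fun _ => 1) (fun _ _ => one_pos)
  haveI : Countable t := tcount.to_subtype
  have tne : t.Nonempty := by
    by_contra hemp
    rw [not_nonempty_iff_eq_empty] at hemp
    rw [hemp] at hnull
    simp only [mem_empty_iff_false, iUnion_of_empty, iUnion_empty, sdiff_empty] at hnull
    exact (hΩo.measure_pos volume hΩne).ne' hnull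
  haveI : Nonempty t := tne.to_subtype
  refine hasWildFamily_of_cover
    (fun i : t => ball (i : ℝ × EuclideanSpace ℝ (Fin 2)) (r i)) (fun i => isOpen_ball)
    (fun i j hij => ?_) (fun i => ball_subset_closedBall.trans (hr i i.2).1) ?_
    (fun i => h i (r i) (hr i i.2).2.1 v₀ u₀ C hsymm htr hC hpos)
  · exact Set.disjoint_of_subset ball_subset_closedBall ball_subset_closedBall
      (hdisj i.2 j.2 (Subtype.coe_injective.ne hij))
  · -- the open balls miss only the null remainder and the null spheres
    have hsub : Ω \ ⋃ i : t, ball (i : ℝ × EuclideanSpace ℝ (Fin 2)) (r i) ⊆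
        (Ω \ ⋃ x ∈ t, closedBall x (r x)) ∪
          ⋃ i : t, sphere (i : ℝ × EuclideanSpace ℝ (Fin 2)) (r i) := by
      rintro z ⟨hzΩ, hz⟩
      by_cases hz' : z ∈ ⋃ x ∈ t, closedBall x (r x)
      · right
        obtain ⟨x, hx, hzx⟩ := mem_iUnion₂.mp hz'
        refine mem_iUnion.mpr ⟨⟨x, hx⟩, ?_⟩
        rw [← closedBall_sdiff_ball]
        exact ⟨hzx, fun hb => hz (mem_iUnion.mpr ⟨⟨x, hx⟩, hb⟩)⟩
      · exact Or.inl ⟨hzΩ, hz'⟩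
    refine measure_mono_null hsub (measure_union_null hnull ?_)
    exact measure_iUnion_null_iff.mpr fun i => Measure.addHaar_sphere volume _ _

/-- The converse of `convexIntegrationLemma2D_of_ball`: the ball case is the special case
`Ω = B(z₀, r)` of Lemma 3.7, so the two named facts are equivalent.
[cite: ChiodaroliDeLellisKreml2015, Lemma 3.7] -/
theorem ConvexIntegrationLemma2DBall.of_lemma (h : ConvexIntegrationLemma2D) :
    ConvexIntegrationLemma2DBall :=
  fun _ _ hr => h _ isOpen_ball (nonempty_ball.2 hr)

/-- `ConvexIntegrationLemma2DBall ↔ ConvexIntegrationLemma2D`. [cite: ChiodaroliDeLellisKreml2015, Lemma 3.7] -/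
theorem convexIntegrationLemma2DBall_iff :
    ConvexIntegrationLemma2DBall ↔ ConvexIntegrationLemma2D :=
  ⟨convexIntegrationLemma2D_of_ball, ConvexIntegrationLemma2DBall.of_lemma⟩

end Literature.Analysis.FluidPDE.ConvexIntegration

end
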